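import Mathlib
import HarnessLib
import Summits.HubbardSuperconductivity.HubbardSuperconductivity.Theorems.KLProgrammeKLRegimeAlphaWtScaleCovDataFlowDeepVol
import Summits.HubbardSuperconductivity.HubbardSuperconductivity.Theorems.KLProgrammeKLRegimeOverlapWtFlowDeepVol
import Summits.HubbardSuperconductivity.HubbardSuperconductivity.Theorems.KLProgrammeKLRegimeTwoVolumeTowerDefs

/-!
# K3 VL child `KLRegimeVolumeLimitV17F2` (stmt-HubbardSuperconductivity-20440), blueprint v5 M3b-j IN THE TOWER'S VOCABULARY: the one-volume covariance data of
# `klStepCov V M β μ K_n k` (both lattices) and the weighted rows / columns of `klReanalysis V M β μ K_n k`, at the COARSE flow frame `K_n`, deep window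

Cell `gate-hubbard-kl`, seat p3 (g12).  `…TwoVolumeTowerDefs` (k3c4-p1 g12, p597478) NAMES the tower's matrices: the step covariance
`klStepCov V M β μ K k = S_V(F̃_k[K])ᵀ·C^K_{(Λ_{k+2},Λ_{k+1}]}(V)·S_V(F̃_k[K])` and the re-analysis block `klReanalysis V M β μ K k = (ε•E_V(F_{k+1}[K]))·S_V(F̃_k[K])`,
`ε = imagTimeWeight β M = β/(2M)`.  The W5 tower spine reads their one-volume data at the common frame `K = K_n` of the coarse volume `L` on both lattices
`V ∈ {L, bL}` (`…TwoVolumeModelScaleSucc` / `…ModelStepLinear`: `hC`, `hC'`, `hCsec`, `hTr`).  This file re-keys p3's lattice-decoupled doors to those names: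

* `klStepCov_eq_klSliceCov` — `klStepCov V M β μ K k = S_V(F̃_k)ᵀ·klSliceCov_V (k+2)·S_V(F̃_k)` (`rfl` on the two definitions);
* **`scaleCovData_klStepCov_klEng_flow_deep_vol (d)`** — `ScaleCovData (klStepCov V M β μ K_n k) Λ_w κ_k (Cα·(M/β)/Λ_{k+2}) Ce` for every lattice `V` with
  `klEngL₃ β U ≤ V`, `klEngM₃ β U V ≤ M`, every `1 ≤ k`, `k + 2 ≤ n_β + 1`, deep window `4^{n+2}·U ≤ 4^{2k+d}`, rate `0 ≤ Λ_w ≤ Λ_{k+2}`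
  (`κ_k = √(Cκ·(Λ_k/Λ_{k+2})·klE0·8^{−k})`; from `scaleCovData_klSliceCov_bgmFat_klEng_flow_deep_vol 2 d`);
* **`scaleCovSecData_klStepCov_klEng_flow_deep_vol (d)`** — `ScaleCovSecData (klStepCov V M β μ K_n k) Λ_w Ce` (ε-free; from
  `scaleCovSecData_klSliceCov_bgmFat_klEng_flow_deep_vol 2 d`; binders without `P.WF` / `klEngU₀4` / `klEngM₃ … V`);
* **`rowColSumWt_klReanalysis_klEng_flow_deep_vol (d)`** — the `klScaleWt V M β (k+1)`-weighted row AND column sums of `klReanalysis V M β μ K_n k` are `≤ 81·C_J`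
  — ε-FREE: the factor `ε = β/(2M)` of the block cancels the `M/β` of `overlapWt_jump_sums_/overlapWt_colSum_klEng_flow_deep_vol` (window `4ⁿ·U ≤ 4^{2(k+1)+d}`,
  `k + 1 ≤ n`); the `(1 + Λ_T·tnorm)` currency of `TransferWtData.row/col` follows by `…TwoVolumeDataKitWt.one_add_mul_tnorm_le_klScaleWt_pair` (`Λ_T ≤ Λ_{k+1}`).
Scale `k = 0` (one sector) is the scale-0 lane's (k3c4-p2), not covered here.

Everything is proved; no definitions. [cite: BenfattoGiulianiMastropietro2006, §2.7 (2.70)–(2.71a), §2.8 (2.77), (2.81)–(2.83), §3 (3.3)]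
-/

noncomputable section

namespace Summit.HubbardSuperconductivity.HubbardSuperconductivity.Theorems.TorusFourierL2

set_option linter.dupNamespace false -- summit = problem name (single-conjunct summit), D-0017

open Set Finset Literature.MathematicalPhysics.QuantumLattice Literature.MathematicalPhysics.QuantumLattice.BandSectorCounting
open Literature.MathematicalPhysics.QuantumLattice.FermiRG Literature.Probability.LatticeModels Literature.Analysis.SpecialFunctions
open Summit.HubbardSuperconductivity.HubbardSuperconductivity.Theorems.DispersionFlow
open Summit.HubbardSuperconductivity.HubbardSuperconductivity.Theorems.KLRegimeSplit
open Summit.HubbardSuperconductivity.HubbardSuperconductivity.Theorems.KLProgrammeLegKernels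
open Summit.HubbardSuperconductivity.HubbardSuperconductivity.Theorems.PerturbedFermiCurve
open Summit.HubbardSuperconductivity.HubbardSuperconductivity.Theorems.KLRegimeWick
open Summit.HubbardSuperconductivity.HubbardSuperconductivity.Theorems.EngineV8
open Summit.HubbardSuperconductivity.HubbardSuperconductivity.Theorems.TwoVolumeSource
open scoped Real Nat

open Classical

/-- **The tower's step covariance is the pull-back of the engine's slice `k+2`**: `klStepCov V M β μ K k = S_V(F̃_k)ᵀ·klSliceCov_V (k+2)·S_V(F̃_k)`
(both sides unfold to `hubbardCovSliceCT V M β μ 0 K Λ_{k+2} Λ_{k+1}`). [folklore] -/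
theorem klStepCov_eq_klSliceCov (V M : ℕ) [NeZero V] [NeZero M] (β μ : ℝ) (K : TrigPolyC4v) (k : ℕ) :
    klStepCov V M β μ K k =
      (sectorSubMatrix V M β (bgmFatMultiplier V M klE0 β (nambuXiCT V μ K) k)).transpose * klSliceCov V M β μ K (k + 2) *
        sectorSubMatrix V M β (bgmFatMultiplier V M klE0 β (nambuXiCT V μ K) k) := by
  rw [klStepCov, klSliceCov, show k + 2 - 1 = k + 1 from rfl]

set_option maxHeartbeats 800000 in -- long binder list
/-- **M3b-j (i) in the tower's vocabulary**: `ScaleCovData (klStepCov V M β μ K_n k) Λ_w κ_k (Cα·(M/β)/Λ_{k+2}) Ce` on every lattice `V`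
(`klEngL₃ β U ≤ V`, `klEngM₃ β U V ≤ M`), `1 ≤ k`, `k + 2 ≤ n_β + 1`, deep window `4^{n+2}·U ≤ 4^{2k+d}`, every rate `0 ≤ Λ_w ≤ Λ_{k+2}` — the `hC`/`hC'`
inputs of the W5 spine at the common frame `K_n`. [cite: BenfattoGiulianiMastropietro2006, §2.8 (2.81), §3 (3.3)] -/
theorem scaleCovData_klStepCov_klEng_flow_deep_vol (dd : ℕ) :
    ∃ Cκ Cα Ce : ℝ, 0 < Cκ ∧ 0 < Cα ∧ 0 < Ce ∧
      ∀ (G : GeoConsts) (P : SplitConsts) (R : RenConsts) (Q : EngConsts) (cc : ℝ), P.WF → R.WF2 → 0 < cc → cc ≤ EngineV8.klEngC₃6 P R →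
      ∀ μ ∈ klWindowC, ∀ U : ℝ, 0 < U → U ≤ min (EngineV8.klEngU₀3 P R cc) (1 / (R.Gfr 3 + 1)) → U ≤ EngineV8.klEngU₀4 P R cc →
      ∀ β : ℝ, klBetaMin ≤ β → β ≤ Real.exp (cc / U ^ 2) →
      ∀ (L M : ℕ) [NeZero L] [NeZero M], EngineV8.klEngL₃ β U ≤ L → EngineV8.klEngM₃ β U L ≤ M →
      ∀ n : ℕ, 1 ≤ n → n ≤ nScales β + 1 →
        HistP klPredsV17F2 L M G P Q R β U μ 0 n → FrameOK R U (nScales β) μ (klFlowFrameU L M β U μ n) →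
        ∀ (V : ℕ) [NeZero V], EngineV8.klEngL₃ β U ≤ V → EngineV8.klEngM₃ β U V ≤ M →
        ∀ k : ℕ, 1 ≤ k → k + 2 ≤ nScales β + 1 → (4 : ℝ) ^ (n + 2) * U ≤ (4 : ℝ) ^ (2 * k + dd) →
        ∀ Λw : ℝ, 0 ≤ Λw → Λw ≤ klScale klE0 (k + 2) →
          TwoVolumeDefect.ScaleCovData (klStepCov V M β μ (klFlowFrameU L M β U μ n) k) Λw
            (Real.sqrt (Cκ * (klScale klE0 k / klScale klE0 (k + 2)) * (klE0 * ((8 : ℝ) ^ k)⁻¹)))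
            (Cα * ((M : ℝ) / β) / klScale klE0 (k + 2)) Ce := by
  obtain ⟨Cκ, Cα, Ce, hCκ, hCα, hCe, h⟩ := scaleCovData_klSliceCov_bgmFat_klEng_flow_deep_vol 2 dd
  refine ⟨Cκ, Cα, Ce, hCκ, hCα, hCe, ?_⟩
  intro G P R Q cc hP hR2 hcc hcc6 μ hμ U hU hUle hU4 β hβmin hβc L M _ _ hL3 hM3 n hn1 hnN hhist hfr V _ hV3 hVM3 k hk hkN hwin Λw hΛw0 hΛwle
  rw [klStepCov_eq_klSliceCov]
  exact h G P R Q cc hP hR2 hcc hcc6 μ hμ U hU hUle hU4 β hβmin hβc L M hL3 hM3 n hn1 hnN hhist hfr V hV3 hVM3 k hk hkN hwin Λw hΛw0 hΛwle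

set_option maxHeartbeats 800000 in -- long binder list
/-- **M3b-j (ii) in the tower's vocabulary**: `ScaleCovSecData (klStepCov V M β μ K_n k) Λ_w Ce` on every lattice `V` (`klEngL₃ β U ≤ V`), `1 ≤ k`,
`k + 2 ≤ n_β + 1`, deep window `4^{n+2}·U ≤ 4^{2k+d}`, every rate `0 ≤ Λ_w ≤ Λ_{k+2}` — the `hCsec` input of the W5 spine at the common frame `K_n` (ε-free).
[cite: BenfattoGiulianiMastropietro2006, §2.8 (2.81), §3 (3.3)] -/
theorem scaleCovSecData_klStepCov_klEng_flow_deep_vol (dd : ℕ) :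
    ∃ Ce : ℝ, 0 < Ce ∧
      ∀ (G : GeoConsts) (P : SplitConsts) (R : RenConsts) (Q : EngConsts) (cc : ℝ), R.WF2 → 0 < cc → cc ≤ EngineV8.klEngC₃6 P R →
      ∀ μ ∈ klWindowC, ∀ U : ℝ, 0 < U → U ≤ min (EngineV8.klEngU₀3 P R cc) (1 / (R.Gfr 3 + 1)) →
      ∀ β : ℝ, klBetaMin ≤ β → β ≤ Real.exp (cc / U ^ 2) →
      ∀ (L M : ℕ) [NeZero L] [NeZero M], EngineV8.klEngL₃ β U ≤ L → EngineV8.klEngM₃ β U L ≤ M →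
      ∀ n : ℕ, 1 ≤ n → n ≤ nScales β + 1 →
        HistP klPredsV17F2 L M G P Q R β U μ 0 n → FrameOK R U (nScales β) μ (klFlowFrameU L M β U μ n) →
        ∀ (V : ℕ) [NeZero V], EngineV8.klEngL₃ β U ≤ V →
        ∀ k : ℕ, 1 ≤ k → k + 2 ≤ nScales β + 1 → (4 : ℝ) ^ (n + 2) * U ≤ (4 : ℝ) ^ (2 * k + dd) →
        ∀ Λw : ℝ, 0 ≤ Λw → Λw ≤ klScale klE0 (k + 2) →
          TwoVolumeDefect.ScaleCovSecData (klStepCov V M β μ (klFlowFrameU L M β U μ n) k) Λw Ce := by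
  obtain ⟨Ce, hCe, h⟩ := scaleCovSecData_klSliceCov_bgmFat_klEng_flow_deep_vol 2 dd
  refine ⟨Ce, hCe, ?_⟩
  intro G P R Q cc hR2 hcc hcc6 μ hμ U hU hUle β hβmin hβc L M _ _ hL3 hM3 n hn1 hnN hhist hfr V _ hV3 k hk hkN hwin Λw hΛw0 hΛwle
  rw [klStepCov_eq_klSliceCov]
  exact h G P R Q cc hR2 hcc hcc6 μ hμ U hU hUle β hβmin hβc L M hL3 hM3 n hn1 hnN hhist hfr V hV3 k hk hkN hwin Λw hΛw0 hΛwle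

set_option maxHeartbeats 800000 in -- long binder list
/-- **M3b-j (iii), re-analysis block, in the tower's vocabulary**: the `klScaleWt V M β (k+1)`-weighted ROW and COLUMN sums of `klReanalysis V M β μ K_n k`
are `≤ 81·C_J`, ε-FREE (the block's factor `ε = β/(2M)` against the overlap doors' `M/β`), on every lattice `V` (`klEngL₃ β U ≤ V`), `k + 1 ≤ n`, deep window
`4ⁿ·U ≤ 4^{2(k+1)+d}` — the `E·S` part of the W5 spine's `hTr` at the common frame `K_n` (up to `…TwoVolumeDataKitWt` §1 and the `⊕ klSlotShift` block).
[cite: BenfattoGiulianiMastropietro2006, §2.7 (2.71a), §2.8 (2.77), (2.82)–(2.83)] -/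
theorem rowColSumWt_klReanalysis_klEng_flow_deep_vol (dd : ℕ) :
    ∃ Cr : ℝ, 0 < Cr ∧
      ∀ (G : GeoConsts) (P : SplitConsts) (R : RenConsts) (Q : EngConsts) (cc : ℝ), R.WF2 → 0 < cc → cc ≤ EngineV8.klEngC₃6 P R →
      ∀ μ ∈ klWindowC, ∀ U : ℝ, 0 < U → U ≤ min (EngineV8.klEngU₀3 P R cc) (1 / (R.Gfr 3 + 1)) →
      ∀ β : ℝ, klBetaMin ≤ β → β ≤ Real.exp (cc / U ^ 2) →
      ∀ (L M : ℕ) [NeZero L] [NeZero M], EngineV8.klEngL₃ β U ≤ L → EngineV8.klEngM₃ β U L ≤ M →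
      ∀ n : ℕ, 1 ≤ n → n ≤ nScales β + 1 →
        HistP klPredsV17F2 L M G P Q R β U μ 0 n → FrameOK R U (nScales β) μ (klFlowFrameU L M β U μ n) →
        ∀ (V : ℕ) [NeZero V], EngineV8.klEngL₃ β U ≤ V →
        ∀ k : ℕ, k + 1 ≤ n → (4 : ℝ) ^ n * U ≤ (4 : ℝ) ^ (2 * (k + 1) + dd) →
        (∀ X'' : SpaceTimeIdx V M × SectorLeg (sectorCount (k + 1)),
          ∑ X' : SpaceTimeIdx V M × SectorLeg (sectorCount k), ‖klReanalysis V M β μ (klFlowFrameU L M β U μ n) k X'' X'‖ *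
            EngineV8.klScaleWt V M β (k + 1) {EngineV8.latticeLegPos (2 * (2 * M)) X'', EngineV8.latticeLegPos (2 * (2 * M)) X'} ≤ Cr) ∧
        (∀ X' : SpaceTimeIdx V M × SectorLeg (sectorCount k),
          ∑ X'' : SpaceTimeIdx V M × SectorLeg (sectorCount (k + 1)), ‖klReanalysis V M β μ (klFlowFrameU L M β U μ n) k X'' X'‖ *
            EngineV8.klScaleWt V M β (k + 1) {EngineV8.latticeLegPos (2 * (2 * M)) X'', EngineV8.latticeLegPos (2 * (2 * M)) X'} ≤ Cr) := by
  obtain ⟨CJ, hCJ, hR⟩ := overlapWt_jump_sums_klEng_flow_deep_vol dd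
  obtain ⟨CJ', hCJ', hC⟩ := overlapWt_colSum_klEng_flow_deep_vol dd
  refine ⟨81 * (CJ + CJ'), by positivity, ?_⟩
  intro G P R Q cc hR2 hcc hcc6 μ hμ U hU hUle β hβmin hβc L M _ _ hL3 hM3 n hn1 hnN hhist hfr V _ hV3 k hkn hwin
  have hβ0 : 0 < β := pos_of_klBetaMin_le hβmin
  have hM0 : (0 : ℝ) < M := lt_of_lt_of_le hβ0 (EngineV8.le_of_klEngM₃_le hβmin hL3 hM3)
  obtain ⟨hrow, -, -⟩ := hR G P R Q cc hR2 hcc hcc6 μ hμ U hU hUle β hβmin hβc L M hL3 hM3 n hn1 hnN hhist hfr V hV3 k (k + 1) le_rfl hkn hwin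
  have hcol := hC G P R Q cc hR2 hcc hcc6 μ hμ U hU hUle β hβmin hβc L M hL3 hM3 n hn1 hnN hhist hfr V hV3 k (k + 1) le_rfl hkn hwin
  -- the block's factor `ε = β/(2M)`
  have hε : ‖(((imagTimeWeight β M : ℝ) : ℂ))‖ = β / (2 * M) := by
    rw [Complex.norm_real, imagTimeWeight, Real.norm_eq_abs, abs_of_nonneg (by positivity)]
  have hentry : ∀ (X'' : SpaceTimeIdx V M × SectorLeg (sectorCount (k + 1))) (X' : SpaceTimeIdx V M × SectorLeg (sectorCount k)),
      ‖klReanalysis V M β μ (klFlowFrameU L M β U μ n) k X'' X'‖ = β / (2 * M) *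
        ‖(sectorAnalysisMatrix V M β (klAnisoFamily V M β μ (klFlowFrameU L M β U μ n) klE0 (k + 1)) *
          sectorSubMatrix V M β (bgmFatMultiplier V M klE0 β (nambuXiCT V μ (klFlowFrameU L M β U μ n)) k)) X'' X'‖ := by
    intro X'' X'
    rw [klReanalysis_eq_smul, Matrix.smul_apply, smul_eq_mul, norm_mul, hε]
  have e2 : (2 : ℝ) ^ (k + 1 - k) = 2 := by rw [show k + 1 - k = 1 by omega, pow_one]
  refine ⟨fun X'' => ?_, fun X' => ?_⟩
  · have h1 := hrow X''
    calc ∑ X', ‖klReanalysis V M β μ (klFlowFrameU L M β U μ n) k X'' X'‖ *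
          EngineV8.klScaleWt V M β (k + 1) {EngineV8.latticeLegPos (2 * (2 * M)) X'', EngineV8.latticeLegPos (2 * (2 * M)) X'}
        = β / (2 * M) * ∑ X', ‖(sectorAnalysisMatrix V M β (klAnisoFamily V M β μ (klFlowFrameU L M β U μ n) klE0 (k + 1)) *
            sectorSubMatrix V M β (bgmFatMultiplier V M klE0 β (nambuXiCT V μ (klFlowFrameU L M β U μ n)) k)) X'' X'‖ *
            EngineV8.klScaleWt V M β (k + 1) {EngineV8.latticeLegPos (2 * (2 * M)) X'', EngineV8.latticeLegPos (2 * (2 * M)) X'} := by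
          rw [Finset.mul_sum]; exact Finset.sum_congr rfl fun X' _ => by rw [hentry]; ring
      _ ≤ β / (2 * M) * (81 * CJ * M / β) := mul_le_mul_of_nonneg_left h1 (by positivity)
      _ = 81 * CJ / 2 := by field_simp
      _ ≤ 81 * (CJ + CJ') := by nlinarith only [hCJ, hCJ']
  · have h1 := hcol X'
    rw [e2] at h1
    calc ∑ X'', ‖klReanalysis V M β μ (klFlowFrameU L M β U μ n) k X'' X'‖ *
          EngineV8.klScaleWt V M β (k + 1) {EngineV8.latticeLegPos (2 * (2 * M)) X'', EngineV8.latticeLegPos (2 * (2 * M)) X'}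
        = β / (2 * M) * ∑ X'', ‖(sectorAnalysisMatrix V M β (klAnisoFamily V M β μ (klFlowFrameU L M β U μ n) klE0 (k + 1)) *
            sectorSubMatrix V M β (bgmFatMultiplier V M klE0 β (nambuXiCT V μ (klFlowFrameU L M β U μ n)) k)) X'' X'‖ *
            EngineV8.klScaleWt V M β (k + 1) {EngineV8.latticeLegPos (2 * (2 * M)) X'', EngineV8.latticeLegPos (2 * (2 * M)) X'} := by
          rw [Finset.mul_sum]; exact Finset.sum_congr rfl fun X'' _ => by rw [hentry]; ring
      _ ≤ β / (2 * M) * (81 * 2 * CJ' * M / β) := mul_le_mul_of_nonneg_left h1 (by positivity)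
      _ = 81 * CJ' := by field_simp
      _ ≤ 81 * (CJ + CJ') := by nlinarith only [hCJ, hCJ']

end Summit.HubbardSuperconductivity.HubbardSuperconductivity.Theorems.TorusFourierL2

end
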